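import Summits.NavierStokesRegularity.NavierStokesRegularity.Theses.CoreLogGas
import Literature.Analysis.FluidPDE.KNSSTypeIIHolds

/-!
# Evidence (lead c2) for crux A `CoreLogGas.LocallyDrivenIsTypeI` (stmt-NavierStokesRegularity-11290), line `registered`

Kernel-checked bookkeeping behind the c2 addendum to `Lines/registered-dead.md`.  Nothing here proves or refutes the
crux; the file certifies the FORMAL parts of the reshape census:

1. `unbounded_of_maximal` — under the crux's standing hypotheses (maximal classical solution on `[0,T)` that is
   Leray–Hopf from its datum) the velocity is unbounded on `[0,T) × ℝ³`.  Uses the PROVED tree fact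
   `hasSmoothExtensionPast_of_bounded_holds` (Robinson–Rodrigo–Sadowski Thm 8.17).  So the conclusion `IsTypeIBlowup u T`
   is never available "for free" from boundedness (`isTypeIBlowup` of a bounded field), and maximality is a genuine
   loss of boundedness at `T`, not a definitional artefact of the no-decay extension predicate.
2. The "vacuity cut" `{H ⇒ u bounded on [0,T)×ℝ³}`: its single stub `BoundedStub` is literally "no H-blow-up"
   (`noHBlowup_of_boundedStub`), which yields A outright (`A_of_noHBlowup`) and, together with crux B, the absence of
   ANY maximal solution (`noMaximal_of_boundedStub_B`) — i.e. the stub is stronger than the crux, so this is not a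
   reshape of the line.
3. The "2-stub rate cut" `{H ⇒ vorticity Type I, vorticity Type I ⇒ velocity Type I}` composes to A
   (`A_of_twoStubCut`), so its failure lies in the stubs (both open a-priori statements), not in the glue.
-/

noncomputable section

open Set MeasureTheory Filter Topology

namespace Summit.NavierStokesRegularity.NavierStokesRegularity.Cruxes.LocallyDrivenIsTypeI.EvidenceC2

open Literature.Analysis.FluidPDE

set_option linter.unusedVariables false
set_option linter.dupNamespace false

/-- The locality hypothesis `H(M, t₀, g)` of crux A, verbatim (rev 3: Biot–Savart velocity written out). -/
def LocH (u : ℝ → EuclideanSpace ℝ (Fin 3) → EuclideanSpace ℝ (Fin 3)) (T : ℝ) : Prop :=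
  ∃ (M t₀ : ℝ) (g : ℝ → ℝ), 1 ≤ M ∧ 0 ≤ t₀ ∧ t₀ < T ∧ MeasureTheory.IntegrableOn g (Set.Ico t₀ T) ∧
    ∀ t ∈ Set.Ico t₀ T, ∀ (x : EuclideanSpace ℝ (Fin 3)) (ρ : ℝ), 0 < ρ →
      (⨆ z, ‖Literature.Analysis.FluidPDE.curl (u t) z‖) ≤ 2 * ‖Literature.Analysis.FluidPDE.curl (u t) x‖ →
      Metric.ball x ρ ⊆ {y | (⨆ z, ‖Literature.Analysis.FluidPDE.curl (u t) z‖) ≤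
        4 * ‖Literature.Analysis.FluidPDE.curl (u t) y‖} →
      (∀ (x' : EuclideanSpace ℝ (Fin 3)) (ρ' : ℝ),
        (⨆ z, ‖Literature.Analysis.FluidPDE.curl (u t) z‖) ≤ 2 * ‖Literature.Analysis.FluidPDE.curl (u t) x'‖ →
        Metric.ball x' ρ' ⊆ {y | (⨆ z, ‖Literature.Analysis.FluidPDE.curl (u t) z‖) ≤
          4 * ‖Literature.Analysis.FluidPDE.curl (u t) y‖} →
        ρ' ≤ 2 * ρ) →
      ∀ e : EuclideanSpace ℝ (Fin 3), ‖e‖ = 1 →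
        |inner ℝ ((fderiv ℝ (u t) x - fderiv ℝ (fun z : EuclideanSpace ℝ (Fin 3) =>
          ∫ y, (4 * Real.pi * ‖z - y‖ ^ 3)⁻¹ • Literature.Analysis.FluidPDE.cross
            ((Metric.ball x (M * ρ)).indicator (Literature.Analysis.FluidPDE.curl (u t)) y) (z - y)) x) e) e| ≤ g t

/-- Read-back: crux A is, by `Iff.rfl`, "standing hypotheses + `LocH` ⇒ `IsTypeIBlowup`". -/
theorem locallyDrivenIsTypeI_iff :
    Theses.CoreLogGas.LocallyDrivenIsTypeI ↔
      ∀ (ν T : ℝ), 0 < ν → 0 < T →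
        ∀ (u : ℝ → EuclideanSpace ℝ (Fin 3) → EuclideanSpace ℝ (Fin 3)) (p : ℝ → EuclideanSpace ℝ (Fin 3) → ℝ),
        IsMaximalSmoothSolution ν 0 u p T → IsLerayHopfOn T ν 0 (u 0) u → HasRapidSpatialDecay (u 0) →
        LocH u T → IsTypeIBlowup u T :=
  Iff.rfl

/-! ### 1. Maximality is genuine unboundedness -/

/-- Under the crux's standing hypotheses the velocity is unbounded on `[0, T) × ℝ³`: otherwise the PROVED continuation
theorem `hasSmoothExtensionPast_of_bounded_holds` (RRS 2016 Thm 8.17) extends the solution past `T`, contradicting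
maximality. -/
theorem unbounded_of_maximal {ν T : ℝ} {u : ℝ → EuclideanSpace ℝ (Fin 3) → EuclideanSpace ℝ (Fin 3)}
    {p : ℝ → EuclideanSpace ℝ (Fin 3) → ℝ} (hν : 0 < ν) (hT : 0 < T)
    (hmax : IsMaximalSmoothSolution ν 0 u p T) (hLH : IsLerayHopfOn T ν 0 (u 0) u) :
    ∀ M : ℝ, ∃ t ∈ Set.Ico 0 T, ∃ x, M < ‖u t x‖ := by
  intro M
  by_contra h
  push Not at h
  exact hmax.2 (hasSmoothExtensionPast_of_bounded_holds hν hT hmax.1 hLH ⟨M, h⟩)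

/-! ### 2. The vacuity cut is not a reshape: its stub is "no H-blow-up" -/

/-- "No H-blow-up": no maximal finite-energy classical solution from a rapidly decaying datum satisfies `LocH`. -/
def NoHBlowup : Prop :=
  ∀ (ν T : ℝ), 0 < ν → 0 < T →
    ∀ (u : ℝ → EuclideanSpace ℝ (Fin 3) → EuclideanSpace ℝ (Fin 3)) (p : ℝ → EuclideanSpace ℝ (Fin 3) → ℝ),
    IsMaximalSmoothSolution ν 0 u p T → IsLerayHopfOn T ν 0 (u 0) u → HasRapidSpatialDecay (u 0) →
    LocH u T → False

/-- The single stub of the vacuity cut: `H`-solutions stay bounded on `[0, T) × ℝ³`. -/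
def BoundedStub : Prop :=
  ∀ (ν T : ℝ), 0 < ν → 0 < T →
    ∀ (u : ℝ → EuclideanSpace ℝ (Fin 3) → EuclideanSpace ℝ (Fin 3)) (p : ℝ → EuclideanSpace ℝ (Fin 3) → ℝ),
    IsMaximalSmoothSolution ν 0 u p T → IsLerayHopfOn T ν 0 (u 0) u → HasRapidSpatialDecay (u 0) →
    LocH u T → ∃ M : ℝ, ∀ t ∈ Set.Ico 0 T, ∀ x, ‖u t x‖ ≤ M

/-- No H-blow-up gives crux A outright (vacuously). -/
theorem A_of_noHBlowup (h : NoHBlowup) : Theses.CoreLogGas.LocallyDrivenIsTypeI :=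
  fun ν T hν hT u p hmax hLH hdec hH => (h ν T hν hT u p hmax hLH hdec hH).elim

/-- The vacuity-cut stub IS "no H-blow-up" (by `unbounded_of_maximal`). -/
theorem noHBlowup_of_boundedStub (h : BoundedStub) : NoHBlowup := by
  intro ν T hν hT u p hmax hLH hdec hH
  obtain ⟨M, hM⟩ := h ν T hν hT u p hmax hLH hdec hH
  obtain ⟨t, ht, x, hx⟩ := unbounded_of_maximal hν hT hmax hLH M
  exact (not_lt.mpr (hM t ht x)) hx

/-- … and together with crux B it excludes every maximal solution from Clay data, i.e. it carries the whole
regularity problem: the stub is stronger than crux A, so the vacuity cut is not a reshape of the line. -/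
theorem noMaximal_of_boundedStub_B (h : BoundedStub) (hB : Theses.CoreLogGas.BlowupIsLocallyDriven)
    {ν T : ℝ} (hν : 0 < ν) (hT : 0 < T)
    {u : ℝ → EuclideanSpace ℝ (Fin 3) → EuclideanSpace ℝ (Fin 3)} {p : ℝ → EuclideanSpace ℝ (Fin 3) → ℝ}
    (hmax : IsMaximalSmoothSolution ν 0 u p T) (hLH : IsLerayHopfOn T ν 0 (u 0) u)
    (hdec : HasRapidSpatialDecay (u 0)) : False :=
  noHBlowup_of_boundedStub h ν T hν hT u p hmax hLH hdec (hB ν T hν hT u p hmax hLH hdec)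

/-! ### 3. The 2-stub rate cut composes (its failure is in the stubs) -/

/-- Stub R1 of the rate cut: `H` forces the vorticity Type-I rate `‖ω(t)‖∞ (T − t) ≤ C` near `T`. -/
def VorticityTypeIOfH : Prop :=
  ∀ (ν T : ℝ), 0 < ν → 0 < T →
    ∀ (u : ℝ → EuclideanSpace ℝ (Fin 3) → EuclideanSpace ℝ (Fin 3)) (p : ℝ → EuclideanSpace ℝ (Fin 3) → ℝ),
    IsMaximalSmoothSolution ν 0 u p T → IsLerayHopfOn T ν 0 (u 0) u → HasRapidSpatialDecay (u 0) →
    LocH u T → ∃ (C t₁ : ℝ), t₁ < T ∧ ∀ t ∈ Set.Ico t₁ T, ∀ x,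
      ‖Literature.Analysis.FluidPDE.curl (u t) x‖ * (T - t) ≤ C

/-- Stub R2 of the rate cut (H-free): vorticity Type I ⇒ velocity Type I for finite-energy classical solutions. -/
def VelocityRateOfVorticityRate : Prop :=
  ∀ (ν T : ℝ), 0 < ν → 0 < T →
    ∀ (u : ℝ → EuclideanSpace ℝ (Fin 3) → EuclideanSpace ℝ (Fin 3)) (p : ℝ → EuclideanSpace ℝ (Fin 3) → ℝ),
    IsClassicalNSSolutionOn (Set.Ico 0 T) ν 0 u p → IsLerayHopfOn T ν 0 (u 0) u → HasRapidSpatialDecay (u 0) →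
    (∃ (C t₁ : ℝ), t₁ < T ∧ ∀ t ∈ Set.Ico t₁ T, ∀ x,
      ‖Literature.Analysis.FluidPDE.curl (u t) x‖ * (T - t) ≤ C) →
    IsTypeIBlowup u T

/-- The rate cut composes to crux A by name. -/
theorem A_of_twoStubCut (h1 : VorticityTypeIOfH) (h2 : VelocityRateOfVorticityRate) :
    Theses.CoreLogGas.LocallyDrivenIsTypeI :=
  fun ν T hν hT u p hmax hLH hdec hH =>
    h2 ν T hν hT u p hmax.1 hLH hdec (h1 ν T hν hT u p hmax hLH hdec hH)

end Summit.NavierStokesRegularity.NavierStokesRegularity.Cruxes.LocallyDrivenIsTypeI.EvidenceC2
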